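import Mathlib
import HarnessLib
import Summits.Ventures.LatticeQCDFlow.Exactness.IMHNaiveRetryBias
import Summits.Ventures.LatticeQCDFlow.Exactness.MetropolisHastingsDensityKernel

/-!
# LatticeQCDFlow / Exactness — LEARNING ON THE JOB, I: CHOOSING THE FLOW BY LOOKING AT THE CONFIGURATION IS NOT EXACT (two exact flow
# samplers for the same target, switched on a region of state space, sample the wrong law: defect identity, two-point witness, and the
# Hastings repair)

HONEST FRAMING: exact (Metropolis-corrected) sampling algorithms for lattice gauge theory;
figures of merit are autocorrelation/cost numbers at stated couplings and volumes; no
continuum-physics claim.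

Venture `LatticeQCDFlow` (cell pub-lqcd), topic `Exactness`, FANOUT row 30 (lean-1 GEN-44, theme LEARNING ON THE JOB — adaptive,
pilot-trained and population flow proposals on a general state space).  NEW WORK of the cell; no definition is introduced, nothing is
cited as a fact.  Tree inputs: `IMHKernel` (`indepMH`, `imhAcceptE`, `imhAcceptMass`, `indepMH_invariant`), the `Bool` bookkeeping of
`IMHNaiveRetryBias` (`NaiveRetryWitness.*`), `MetropolisHastingsDensityKernel` (`metropolisHastings_invariant`).  The tree's
`OnlineAdaptation` is the FINITE-state caricature (two Metropolis matrices on `Fin 2`); flows propose on continuous groups, and the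
object that is retrained in practice is the flow itself.  Printed counterparts NAMED ONLY: adaptive MCMC (Roberts–Rosenthal 2007,
Diminishing Adaptation + Containment), adaptive independence samplers with normalizing flows (Brofos–Gabrié–Brubaker–Lederman 2022),
self-learning Monte Carlo for lattice fields with weights updated during the run.

## Setting (general measurable state space `Ω`)
A target measure `π` and TWO Markov kernels `P₀`, `P₁`, EACH exact for `π` — the flow sampler before and after a retraining
(`indepMH q₀ w₀`, `indepMH q₁ w₁` with `w₀·q₀ = w₁·q₁ = π`), or any two exact updates.  A measurable region `S ⊆ Ω`.  THE SELF-TUNED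
SAMPLER uses `P₁` from configurations in `S` and `P₀` from configurations outside: DEF-FREE, `K` is ANY kernel with `K(x, ·) = P₁(x, ·)`
for `x ∈ S` and `K(x, ·) = P₀(x, ·)` for `x ∉ S` (hypotheses `hKS`, `hKSc`; Mathlib's `Kernel.piecewise` is one, `selfTuned_exists`).
This is the one-step content of "look at the current configuration, decide which flow (which parameters) to propose from, and accept with
THAT flow's own importance ratio `min(1, w_θ(y)/w_θ(x))`".

## Results (no `sorry`)
* §1 `selfTuned_bind_apply` — `(μK)(B) = ∫_S P₁(x, B) dμ + ∫_{Sᶜ} P₀(x, B) dμ`; `selfTuned_isMarkovKernel`; `selfTuned_exists`.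
* §2 **`selfTuned_bind_apply_add`** — THE DEFECT IDENTITY: if `P₁` is exact, `(πK)(B) + ∫_{Sᶜ} P₁(x, B) dπ = π(B) + ∫_{Sᶜ} P₀(x, B) dπ`
  (and symmetrically with `S`, `P₀` exact: `selfTuned_bind_apply_add'`).  The self-tuned sampler is exact iff the two exact kernels move
  the restricted measure `π|_{Sᶜ}` (equivalently `π|_S`) to the same place — which two different flows do not do.
  `selfTuned_bind_apply_eq_of_setLIntegral_eq` — the sharp sufficient condition; `selfTuned_bind_apply_eq_of_eq` — trivial repairs:
  the same kernel on both sides.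
* §3 THE TWO-POINT WITNESS (`Bool`, `π = w·q` with `q` uniform, `w = (1, 2)`): `P₀ = indepMH q w` (the flow sampler with the uniform
  flow), `P₁` = the sampler with the PERFECT flow `q₁ = π/π(Ω) = (1/3, 2/3)`, constant weight `3/2` (always accepts); use the perfect flow
  from `true` and the uniform one from `false`: **`selfTuned_bind_apply_false`** — EVERY kernel realising the rule moves `π({false}) = 1/2`
  to `7/12` in one step; **`selfTuned_not_invariant`**; `SelfTunedWitness.perfect_invariant` ∕ `SelfTunedWitness.uniform_invariant` —
  both constituents ARE exact; `SelfTunedWitness.flows_exist`.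
* §4 THE REPAIR (`selfTuned_hastings_invariant`): choosing the proposal DENSITY by the current configuration — `g₁(·)` from `S`, `g₀(·)`
  from `Sᶜ`, against a reference measure — and accepting with the HASTINGS ratio `p(y)g_{σ(y)}(x)/(p(x)g_{σ(x)}(y))`, which prices the
  REVERSE move with the flow the proposal state would have chosen, is exact for every region and every pair of positive flow densities
  (an instance of the tree's `metropolisHastings_invariant`).
Reading (gauge files): switching to a retrained flow as a function of where the chain currently is (a sector, an action band, a
diagnostic computed from the configuration) biases the run even though every flow, frozen, gives an exact sampler; either the switch does
not read the chain (schedule ∕ exogenous data: `ExogenousAdaptationExact`), or the reverse proposal density enters the test.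
-/

namespace Summit.Ventures.LatticeQCDFlow.Exactness

open MeasureTheory ProbabilityTheory
open scoped ENNReal

variable {Ω : Type*} [MeasurableSpace Ω] {π : Measure Ω} {S : Set Ω}

/-! ## §1 The self-tuned kernel -/

/-- Pointwise form of the selection: `K(x, B) = 1_S(x)P₁(x, B) + 1_{Sᶜ}(x)P₀(x, B)`. [ours, bookkeeping] -/
theorem selfTuned_apply_eq_indicator (P₀ P₁ K : Kernel Ω Ω)
    (hKS : ∀ x ∈ S, ∀ {B : Set Ω}, MeasurableSet B → K x B = P₁ x B)
    (hKSc : ∀ x ∉ S, ∀ {B : Set Ω}, MeasurableSet B → K x B = P₀ x B) (x : Ω) {B : Set Ω} (hB : MeasurableSet B) :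
    K x B = S.indicator (fun x => P₁ x B) x + Sᶜ.indicator (fun x => P₀ x B) x := by
  by_cases hx : x ∈ S
  · rw [hKS x hx hB, Set.indicator_of_mem hx, Set.indicator_of_notMem (Set.notMem_compl_iff.2 hx), add_zero]
  · rw [hKSc x hx hB, Set.indicator_of_notMem hx, Set.indicator_of_mem (Set.mem_compl hx), zero_add]

/-- The self-tuned kernel is Markov when both constituents are. [ours, bookkeeping] -/
theorem selfTuned_isMarkovKernel (P₀ P₁ K : Kernel Ω Ω) [IsMarkovKernel P₀] [IsMarkovKernel P₁]
    (hKS : ∀ x ∈ S, ∀ {B : Set Ω}, MeasurableSet B → K x B = P₁ x B)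
    (hKSc : ∀ x ∉ S, ∀ {B : Set Ω}, MeasurableSet B → K x B = P₀ x B) : IsMarkovKernel K := by
  refine ⟨fun x => ⟨?_⟩⟩
  by_cases hx : x ∈ S
  · rw [hKS x hx MeasurableSet.univ, measure_univ]
  · rw [hKSc x hx MeasurableSet.univ, measure_univ]

/-- **`(μK)(B) = ∫_S P₁(x, B) dμ + ∫_{Sᶜ} P₀(x, B) dμ`** for every measure `μ`. [ours] -/
theorem selfTuned_bind_apply (hS : MeasurableSet S) (P₀ P₁ K : Kernel Ω Ω)
    (hKS : ∀ x ∈ S, ∀ {B : Set Ω}, MeasurableSet B → K x B = P₁ x B)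
    (hKSc : ∀ x ∉ S, ∀ {B : Set Ω}, MeasurableSet B → K x B = P₀ x B) (μ : Measure Ω) {B : Set Ω} (hB : MeasurableSet B) :
    (μ.bind K) B = ∫⁻ x in S, P₁ x B ∂μ + ∫⁻ x in Sᶜ, P₀ x B ∂μ := by
  have h1 : Measurable fun x => P₁ x B := Kernel.measurable_coe P₁ hB
  have h0 : Measurable fun x => P₀ x B := Kernel.measurable_coe P₀ hB
  rw [Measure.bind_apply hB (Kernel.aemeasurable _)]
  simp_rw [selfTuned_apply_eq_indicator P₀ P₁ K hKS hKSc _ hB]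
  rw [lintegral_add_left (h1.indicator hS), lintegral_indicator hS, lintegral_indicator hS.compl]

/-- The hypothesis is not vacuous: Mathlib's `Kernel.piecewise` realises the self-tuned sampler. [ours, bookkeeping] -/
theorem selfTuned_exists (hS : MeasurableSet S) (P₀ P₁ : Kernel Ω Ω) :
    ∃ K : Kernel Ω Ω, (∀ x ∈ S, ∀ {B : Set Ω}, MeasurableSet B → K x B = P₁ x B) ∧
      (∀ x ∉ S, ∀ {B : Set Ω}, MeasurableSet B → K x B = P₀ x B) := by
  classical
  refine ⟨Kernel.piecewise hS P₁ P₀, fun x hx B _ => ?_, fun x hx B _ => ?_⟩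
  · rw [Kernel.piecewise_apply, if_pos hx]
  · rw [Kernel.piecewise_apply, if_neg hx]

/-! ## §2 The defect identity -/

/-- Invariance read set-wise: `∫ P(x, B) dπ = π(B)`. [ours, bookkeeping] -/
theorem lintegral_apply_eq_of_invariant (P : Kernel Ω Ω) (hP : Kernel.Invariant P π) {B : Set Ω} (hB : MeasurableSet B) :
    ∫⁻ x, P x B ∂π = π B := by
  have := congrArg (fun μ : Measure Ω => μ B) hP.def
  simpa only [Measure.bind_apply hB (Kernel.aemeasurable _)] using this

/-- **THE DEFECT IDENTITY**: if `P₁` is exact for `π`, then for EVERY kernel realising the self-tuned rule,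
`(πK)(B) + ∫_{Sᶜ} P₁(x, B) dπ = π(B) + ∫_{Sᶜ} P₀(x, B) dπ`.  The sampler is exact iff the two exact kernels transport the restricted
measure `π|_{Sᶜ}` identically. [ours] -/
theorem selfTuned_bind_apply_add (hS : MeasurableSet S) (P₀ P₁ K : Kernel Ω Ω) (hP₁ : Kernel.Invariant P₁ π)
    (hKS : ∀ x ∈ S, ∀ {B : Set Ω}, MeasurableSet B → K x B = P₁ x B)
    (hKSc : ∀ x ∉ S, ∀ {B : Set Ω}, MeasurableSet B → K x B = P₀ x B) {B : Set Ω} (hB : MeasurableSet B) :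
    (π.bind K) B + ∫⁻ x in Sᶜ, P₁ x B ∂π = π B + ∫⁻ x in Sᶜ, P₀ x B ∂π := by
  have hsplit : ∫⁻ x, P₁ x B ∂π = ∫⁻ x in S, P₁ x B ∂π + ∫⁻ x in Sᶜ, P₁ x B ∂π := (lintegral_add_compl _ hS).symm
  rw [selfTuned_bind_apply hS P₀ P₁ K hKS hKSc π hB, ← lintegral_apply_eq_of_invariant P₁ hP₁ hB, hsplit]
  ring

/-- **THE DEFECT IDENTITY, MIRRORED**: if `P₀` is exact for `π`, `(πK)(B) + ∫_S P₀(x, B) dπ = π(B) + ∫_S P₁(x, B) dπ`. [ours] -/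
theorem selfTuned_bind_apply_add' (hS : MeasurableSet S) (P₀ P₁ K : Kernel Ω Ω) (hP₀ : Kernel.Invariant P₀ π)
    (hKS : ∀ x ∈ S, ∀ {B : Set Ω}, MeasurableSet B → K x B = P₁ x B)
    (hKSc : ∀ x ∉ S, ∀ {B : Set Ω}, MeasurableSet B → K x B = P₀ x B) {B : Set Ω} (hB : MeasurableSet B) :
    (π.bind K) B + ∫⁻ x in S, P₀ x B ∂π = π B + ∫⁻ x in S, P₁ x B ∂π := by
  have hsplit : ∫⁻ x, P₀ x B ∂π = ∫⁻ x in S, P₀ x B ∂π + ∫⁻ x in Sᶜ, P₀ x B ∂π := (lintegral_add_compl _ hS).symm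
  rw [selfTuned_bind_apply hS P₀ P₁ K hKS hKSc π hB, ← lintegral_apply_eq_of_invariant P₀ hP₀ hB, hsplit]
  ring

/-- **SHARP SUFFICIENT CONDITION**: if `P₁` is exact and the two kernels agree on `π|_{Sᶜ}` for the set `B` of finite mass, then
`(πK)(B) = π(B)`. [ours] -/
theorem selfTuned_bind_apply_eq_of_setLIntegral_eq (hS : MeasurableSet S) (P₀ P₁ K : Kernel Ω Ω) [IsMarkovKernel P₁]
    (hP₁ : Kernel.Invariant P₁ π)
    (hKS : ∀ x ∈ S, ∀ {B : Set Ω}, MeasurableSet B → K x B = P₁ x B)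
    (hKSc : ∀ x ∉ S, ∀ {B : Set Ω}, MeasurableSet B → K x B = P₀ x B) {B : Set Ω} (hB : MeasurableSet B)
    (hagree : ∫⁻ x in Sᶜ, P₁ x B ∂π = ∫⁻ x in Sᶜ, P₀ x B ∂π) (hfin : π Sᶜ ≠ ⊤) : (π.bind K) B = π B := by
  have h := selfTuned_bind_apply_add hS P₀ P₁ K hP₁ hKS hKSc hB
  rw [hagree] at h
  have hle : ∫⁻ x in Sᶜ, P₀ x B ∂π ≠ ⊤ := by
    rw [← hagree]
    refine ne_top_of_le_ne_top ?_ (lintegral_mono fun x => (prob_le_one : P₁ x B ≤ 1))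
    rwa [setLIntegral_const, one_mul]
  exact (ENNReal.add_left_inj hle).1 h

/-- **TRIVIAL REPAIR**: with the same exact kernel on both sides the "self-tuned" sampler is that kernel, hence exact. [ours] -/
theorem selfTuned_bind_apply_eq_of_eq (hS : MeasurableSet S) (P K : Kernel Ω Ω) [IsMarkovKernel P] (hP : Kernel.Invariant P π)
    (hKS : ∀ x ∈ S, ∀ {B : Set Ω}, MeasurableSet B → K x B = P x B)
    (hKSc : ∀ x ∉ S, ∀ {B : Set Ω}, MeasurableSet B → K x B = P x B) {B : Set Ω} (hB : MeasurableSet B) :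
    (π.bind K) B = π B := by
  rw [selfTuned_bind_apply hS P P K hKS hKSc π hB, lintegral_add_compl _ hS]
  exact lintegral_apply_eq_of_invariant P hP hB

/-! ## §3 The two-point witness: the uniform flow and the perfect flow, switched by the current state -/

section SelfTunedWitness

variable {q q₁ : Measure Bool} {w : Bool → ℝ}

/-- The perfect-flow sampler on the witness: flow `q₁ = (1/3, 2/3)`, constant weight — every draw is accepted, `P₁(x, B) = q₁(B)`.
[ours, bookkeeping] -/
theorem SelfTunedWitness.perfect_apply (P₁ : Kernel Bool Bool)
    (hP₁ : ∀ (x : Bool) {B : Set Bool}, MeasurableSet B → P₁ x B =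
      ∫⁻ y in B, imhAcceptE (fun _ : Bool => (3 / 2 : ℝ)) x y ∂q₁ + (1 - imhAcceptMass q₁ (fun _ : Bool => (3 / 2 : ℝ)) x) * B.indicator 1 x)
    [IsProbabilityMeasure q₁] (x : Bool) {B : Set Bool} (hB : MeasurableSet B) : P₁ x B = q₁ B := by
  have ha : ∀ y, imhAcceptE (fun _ : Bool => (3 / 2 : ℝ)) x y = 1 := fun y => by
    simp [imhAcceptE, imhAccept]
  have hA : imhAcceptMass q₁ (fun _ : Bool => (3 / 2 : ℝ)) x = 1 := by
    simp only [imhAcceptMass, ha, lintegral_const, measure_univ, mul_one]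
  rw [hP₁ x hB]
  simp only [ha, hA, setLIntegral_const, one_mul, tsub_self, zero_mul, add_zero]

/-- `P₁(x, {false}) = 1/3` on the witness. [ours, bookkeeping] -/
theorem SelfTunedWitness.perfect_apply_false (hq₁f : q₁ {false} = ENNReal.ofReal 3⁻¹) (P₁ : Kernel Bool Bool)
    (hP₁ : ∀ (x : Bool) {B : Set Bool}, MeasurableSet B → P₁ x B =
      ∫⁻ y in B, imhAcceptE (fun _ : Bool => (3 / 2 : ℝ)) x y ∂q₁ + (1 - imhAcceptMass q₁ (fun _ : Bool => (3 / 2 : ℝ)) x) * B.indicator 1 x)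
    [IsProbabilityMeasure q₁] (x : Bool) : P₁ x {false} = ENNReal.ofReal 3⁻¹ := by
  rw [SelfTunedWitness.perfect_apply P₁ hP₁ x (measurableSet_singleton _), hq₁f]

/-- `P₀(false, {false}) = 1/2`, `P₀(true, {false}) = 1/4` for the uniform-flow sampler of the witness. [ours, bookkeeping] -/
theorem SelfTunedWitness.uniform_apply_false (hq : ∀ b, q {b} = ENNReal.ofReal 2⁻¹) (hwf : w false = 1) (hwt : w true = 2)
    (P₀ : Kernel Bool Bool)
    (hP₀ : ∀ (x : Bool) {B : Set Bool}, MeasurableSet B → P₀ x B =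
      ∫⁻ y in B, imhAcceptE w x y ∂q + (1 - imhAcceptMass q w x) * B.indicator 1 x) :
    P₀ false {false} = ENNReal.ofReal 2⁻¹ ∧ P₀ true {false} = ENNReal.ofReal 4⁻¹ := by
  obtain ⟨hff, -, htf, -⟩ := NaiveRetryWitness.imhAcceptE_eq hwf hwt
  obtain ⟨hAf, -⟩ := NaiveRetryWitness.imhAcceptMass_eq hq hwf hwt
  constructor
  · rw [hP₀ false (measurableSet_singleton _), NaiveRetryWitness.setLIntegral_false_eq hq, hff, hAf, tsub_self, zero_mul,
      add_zero, one_mul]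
  · rw [hP₀ true (measurableSet_singleton _), NaiveRetryWitness.setLIntegral_false_eq hq, htf,
      Set.indicator_of_notMem (by simp), mul_zero, add_zero, ← ENNReal.ofReal_mul (by norm_num)]
    norm_num

/-- **THE WITNESS, QUANTIFIED**: target `π = w·q` on `Bool` (`q` uniform, `w = (1, 2)`, so `π({false}) = 1/2`, `π({true}) = 1`); the
uniform-flow sampler `P₀` from `false`, the perfect-flow sampler `P₁` from `true` (`S = {true}`): EVERY kernel realising the self-tuned
rule gives `(πK)({false}) = 7/12`. [ours] -/
theorem selfTuned_bind_apply_false (hq : ∀ b, q {b} = ENNReal.ofReal 2⁻¹) (hwf : w false = 1) (hwt : w true = 2)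
    (hq₁f : q₁ {false} = ENNReal.ofReal 3⁻¹) [IsProbabilityMeasure q₁] (P₀ P₁ : Kernel Bool Bool)
    (hP₀ : ∀ (x : Bool) {B : Set Bool}, MeasurableSet B → P₀ x B =
      ∫⁻ y in B, imhAcceptE w x y ∂q + (1 - imhAcceptMass q w x) * B.indicator 1 x)
    (hP₁ : ∀ (x : Bool) {B : Set Bool}, MeasurableSet B → P₁ x B =
      ∫⁻ y in B, imhAcceptE (fun _ : Bool => (3 / 2 : ℝ)) x y ∂q₁ + (1 - imhAcceptMass q₁ (fun _ : Bool => (3 / 2 : ℝ)) x) * B.indicator 1 x)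
    (K : Kernel Bool Bool)
    (hKS : ∀ x ∈ ({true} : Set Bool), ∀ {B : Set Bool}, MeasurableSet B → K x B = P₁ x B)
    (hKSc : ∀ x ∉ ({true} : Set Bool), ∀ {B : Set Bool}, MeasurableSet B → K x B = P₀ x B) :
    ((q.withDensity fun y => ENNReal.ofReal (w y)).bind K) {false} = ENNReal.ofReal (7 / 12) := by
  obtain ⟨hπf, hπt⟩ := NaiveRetryWitness.target_eq hq hwf hwt
  have hKf : K false {false} = ENNReal.ofReal 2⁻¹ := by
    rw [hKSc false (by simp) (measurableSet_singleton _), (SelfTunedWitness.uniform_apply_false hq hwf hwt P₀ hP₀).1]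
  have hKt : K true {false} = ENNReal.ofReal 3⁻¹ := by
    rw [hKS true (by simp) (measurableSet_singleton _), SelfTunedWitness.perfect_apply_false hq₁f P₁ hP₁]
  rw [Measure.bind_apply (measurableSet_singleton _) (Kernel.aemeasurable _), lintegral_fintype, Fintype.sum_bool,
    hKf, hKt, hπf, hπt, mul_one, ← ENNReal.ofReal_mul (by norm_num), ← ENNReal.ofReal_add (by norm_num) (by norm_num)]
  norm_num

/-- **CHOOSING THE FLOW BY THE CURRENT STATE IS NOT EXACT**: on the two-point space, for EVERY kernel realising the self-tuned rule
(perfect flow from `true`, uniform flow from `false`, each with its own importance ratio), `π` is NOT invariant. [ours] -/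
theorem selfTuned_not_invariant (hq : ∀ b, q {b} = ENNReal.ofReal 2⁻¹) (hwf : w false = 1) (hwt : w true = 2)
    (hq₁f : q₁ {false} = ENNReal.ofReal 3⁻¹) [IsProbabilityMeasure q₁] (P₀ P₁ : Kernel Bool Bool)
    (hP₀ : ∀ (x : Bool) {B : Set Bool}, MeasurableSet B → P₀ x B =
      ∫⁻ y in B, imhAcceptE w x y ∂q + (1 - imhAcceptMass q w x) * B.indicator 1 x)
    (hP₁ : ∀ (x : Bool) {B : Set Bool}, MeasurableSet B → P₁ x B =
      ∫⁻ y in B, imhAcceptE (fun _ : Bool => (3 / 2 : ℝ)) x y ∂q₁ + (1 - imhAcceptMass q₁ (fun _ : Bool => (3 / 2 : ℝ)) x) * B.indicator 1 x)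
    (K : Kernel Bool Bool)
    (hKS : ∀ x ∈ ({true} : Set Bool), ∀ {B : Set Bool}, MeasurableSet B → K x B = P₁ x B)
    (hKSc : ∀ x ∉ ({true} : Set Bool), ∀ {B : Set Bool}, MeasurableSet B → K x B = P₀ x B) :
    ¬ Kernel.Invariant K (q.withDensity fun y => ENNReal.ofReal (w y)) := by
  intro h
  have h1 := congrArg (fun μ : Measure Bool => μ {false}) h.def
  rw [selfTuned_bind_apply_false hq hwf hwt hq₁f P₀ P₁ hP₀ hP₁ K hKS hKSc, (NaiveRetryWitness.target_eq hq hwf hwt).1,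
    ENNReal.ofReal_eq_ofReal_iff (by norm_num) (by norm_num)] at h1
  norm_num at h1

/-- **BOTH CONSTITUENTS ARE EXACT, I**: the uniform-flow sampler `P₀ = indepMH q w` leaves `π = w·q` invariant (the tree's
`indepMH_invariant`, transported along the set-wise hypothesis). [ours] -/
theorem SelfTunedWitness.uniform_invariant [IsProbabilityMeasure q] (hwf : w false = 1) (hwt : w true = 2) (P₀ : Kernel Bool Bool)
    (hP₀ : ∀ (x : Bool) {B : Set Bool}, MeasurableSet B → P₀ x B =
      ∫⁻ y in B, imhAcceptE w x y ∂q + (1 - imhAcceptMass q w x) * B.indicator 1 x) :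
    Kernel.Invariant P₀ (q.withDensity fun y => ENNReal.ofReal (w y)) := by
  have hw : Measurable w := measurable_of_countable w
  have hw0 : ∀ x, 0 < w x := fun x => by cases x <;> simp [hwf, hwt]
  have hPK : P₀ = indepMH q w := by
    ext x B hB
    rw [hP₀ x hB, indepMH_apply hw x hB]
  rw [hPK]
  exact indepMH_invariant hw hw0

/-- **BOTH CONSTITUENTS ARE EXACT, II**: the perfect-flow sampler leaves `π = w·q` invariant, because `(3/2)·q₁ = w·q` IS the target
(`q₁ = (1/3, 2/3)`, `w·q = (1/2, 1)`). [ours] -/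
theorem SelfTunedWitness.perfect_invariant (hq : ∀ b, q {b} = ENNReal.ofReal 2⁻¹) (hwf : w false = 1) (hwt : w true = 2)
    (hq₁f : q₁ {false} = ENNReal.ofReal 3⁻¹) (hq₁t : q₁ {true} = ENNReal.ofReal (2 / 3)) [IsProbabilityMeasure q₁]
    (P₁ : Kernel Bool Bool)
    (hP₁ : ∀ (x : Bool) {B : Set Bool}, MeasurableSet B → P₁ x B =
      ∫⁻ y in B, imhAcceptE (fun _ : Bool => (3 / 2 : ℝ)) x y ∂q₁ + (1 - imhAcceptMass q₁ (fun _ : Bool => (3 / 2 : ℝ)) x) * B.indicator 1 x) :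
    Kernel.Invariant P₁ (q.withDensity fun y => ENNReal.ofReal (w y)) := by
  obtain ⟨hπf, hπt⟩ := NaiveRetryWitness.target_eq hq hwf hwt
  have hw₁ : Measurable (fun _ : Bool => (3 / 2 : ℝ)) := measurable_const
  have hPK : P₁ = indepMH q₁ (fun _ : Bool => (3 / 2 : ℝ)) := by
    ext x B hB
    rw [hP₁ x hB, indepMH_apply hw₁ x hB]
  -- the two descriptions of the target agree: `(3/2)·q₁ = w·q`
  have htarget : (q₁.withDensity fun _ => ENNReal.ofReal (3 / 2 : ℝ)) = q.withDensity fun y => ENNReal.ofReal (w y) := by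
    rw [Measure.ext_iff_singleton]
    intro b
    rw [withDensity_apply _ (measurableSet_singleton _), lintegral_singleton]
    cases b
    · rw [hπf, hq₁f, ← ENNReal.ofReal_mul (by norm_num)]; norm_num
    · rw [hπt, hq₁t, ← ENNReal.ofReal_mul (by norm_num)]; norm_num
  rw [hPK, ← htarget]
  exact indepMH_invariant hw₁ (fun _ => by norm_num)

/-- The two flows of the witness exist (uniform: `NaiveRetryWitness.uniform_exists`; perfect: here). [ours, bookkeeping] -/
theorem SelfTunedWitness.flows_exist :
    ∃ q₁ : Measure Bool, IsProbabilityMeasure q₁ ∧ q₁ {false} = ENNReal.ofReal 3⁻¹ ∧ q₁ {true} = ENNReal.ofReal (2 / 3) := by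
  refine ⟨ENNReal.ofReal 3⁻¹ • Measure.dirac false + ENNReal.ofReal (2 / 3) • Measure.dirac true, ⟨?_⟩, ?_, ?_⟩
  · rw [Measure.add_apply, Measure.smul_apply, Measure.smul_apply, measure_univ, measure_univ, smul_eq_mul, mul_one,
      smul_eq_mul, mul_one, ← ENNReal.ofReal_add (by norm_num) (by norm_num)]
    norm_num
  · simp [Measure.dirac_apply']
  · simp [Measure.dirac_apply']

end SelfTunedWitness

/-! ## §4 The repair: the reverse proposal density enters the test -/

section Hastings

variable {μ : Measure Ω} [SFinite μ] {p : Ω → ℝ} {g₀ g₁ : Ω → ℝ}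

/-- The state-dependent proposal density of the self-tuned flow: `κ(x, y) = g₁(y)` for `x ∈ S`, `g₀(y)` otherwise. Measurability.
[ours, bookkeeping] -/
theorem measurable_selfTunedDensity (hS : MeasurableSet S) (hg₀ : Measurable g₀) (hg₁ : Measurable g₁) :
    Measurable (Function.uncurry fun x y : Ω => S.indicator (fun _ => g₁ y) x + Sᶜ.indicator (fun _ => g₀ y) x) := by
  have h : (Function.uncurry fun x y : Ω => S.indicator (fun _ => g₁ y) x + Sᶜ.indicator (fun _ => g₀ y) x) =
      fun z : Ω × Ω => (Prod.fst ⁻¹' S).indicator (fun z => g₁ z.2) z + (Prod.fst ⁻¹' S)ᶜ.indicator (fun z => g₀ z.2) z := by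
    funext z
    by_cases hz : z.1 ∈ S
    · simp [Function.uncurry, Set.indicator, hz]
    · simp [Function.uncurry, Set.indicator, hz]
  rw [h]
  exact ((hg₁.comp measurable_snd).indicator (measurable_fst hS)).add
    ((hg₀.comp measurable_snd).indicator (measurable_fst hS).compl)

omit [MeasurableSpace Ω] [SFinite μ] in
/-- The self-tuned density is positive when both flows are. [ours, bookkeeping] -/
theorem selfTunedDensity_pos (hg₀ : ∀ y, 0 < g₀ y) (hg₁ : ∀ y, 0 < g₁ y) (x y : Ω) :
    0 < S.indicator (fun _ => g₁ y) x + Sᶜ.indicator (fun _ => g₀ y) x := by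
  by_cases hx : x ∈ S
  · rw [Set.indicator_of_mem hx, Set.indicator_of_notMem (Set.notMem_compl_iff.2 hx), add_zero]; exact hg₁ y
  · rw [Set.indicator_of_notMem hx, Set.indicator_of_mem (Set.mem_compl hx), zero_add]; exact hg₀ y

/-- **THE HASTINGS REPAIR IS EXACT**: propose from the flow density `g₁` when the current configuration lies in `S` and from `g₀`
otherwise (densities against any s-finite reference `μ`, target `p·μ`), and accept with
`min(1, p(y)κ(y, x)/(p(x)κ(x, y)))`, `κ(x, ·)` the density so chosen — the reverse factor `κ(y, x)` is the density of `x` under the flow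
that the PROPOSED configuration selects.  Every kernel realising this rule leaves `p·μ` invariant, for every region `S`. [ours — an
instance of the tree's `metropolisHastings_invariant`] -/
theorem selfTuned_hastings_invariant (hS : MeasurableSet S) (hp : Measurable p) (hp0 : ∀ x, 0 < p x) (hg₀ : Measurable g₀)
    (hg₁ : Measurable g₁) (hg₀0 : ∀ y, 0 < g₀ y) (hg₁0 : ∀ y, 0 < g₁ y) (K : Kernel Ω Ω) [IsMarkovKernel K]
    (hK : ∀ (x : Ω) {B : Set Ω}, MeasurableSet B → K x B =
      ∫⁻ y in B, ENNReal.ofReal ((S.indicator (fun _ => g₁ y) x + Sᶜ.indicator (fun _ => g₀ y) x) *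
          min 1 (p y * (S.indicator (fun _ => g₁ x) y + Sᶜ.indicator (fun _ => g₀ x) y) /
            (p x * (S.indicator (fun _ => g₁ y) x + Sᶜ.indicator (fun _ => g₀ y) x)))) ∂μ +
        (1 - ∫⁻ y, ENNReal.ofReal ((S.indicator (fun _ => g₁ y) x + Sᶜ.indicator (fun _ => g₀ y) x) *
          min 1 (p y * (S.indicator (fun _ => g₁ x) y + Sᶜ.indicator (fun _ => g₀ x) y) /
            (p x * (S.indicator (fun _ => g₁ y) x + Sᶜ.indicator (fun _ => g₀ y) x)))) ∂μ) * B.indicator 1 x) :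
    Kernel.Invariant K (μ.withDensity fun x => ENNReal.ofReal (p x)) :=
  metropolisHastings_invariant (κ := fun x y => S.indicator (fun _ => g₁ y) x + Sᶜ.indicator (fun _ => g₀ y) x) hp hp0
    (measurable_selfTunedDensity hS hg₀ hg₁) (selfTunedDensity_pos hg₀0 hg₁0) K hK

end Hastings

end Summit.Ventures.LatticeQCDFlow.Exactness
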